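import Literature.NumberTheory.EllipticCurves.HeegnerPointsShimuraReciprocityProofs
import Literature.NumberTheory.EllipticCurves.RingClassFieldGenusDiscriminantProofs
import Literature.NumberTheory.EllipticCurves.HeegnerPointsOfConductor
import Literature.NumberTheory.QuadraticFields.SquareRootGenerator
import Literature.NumberTheory.QuadraticFields.HeegnerCondition
import Literature.NumberTheory.QuadraticFields.AmbiguousClassesOrder
import HarnessLib

set_option linter.dupNamespace false -- namespace `…BirchSwinnertonDyer.BirchSwinnertonDyer…` is the cell's (D-0017 nested layout)
set_option autoImplicit false

/-!
# The genus field of `ℚ(√−q)` INSIDE the Hilbert class field, from Shimura reciprocity, I: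
# descent of points, and `J := H_K^{θ(Cl²)} = K ⊕ K√q` for `d_K = −4q` (no class-field-theory fact needed)

Cell `bsd-goldfeld`, seat `bsd-goldfeld-s1p-c201` (prover, gen 13), order `ROUTE-S1PLUS/planner-g30/c201_GO.txt`;
`--supports stmt-BirchSwinnertonDyer-20044` (route decl
`Summit.BirchSwinnertonDyer.BirchSwinnertonDyer.Theses.GoldfeldAllTwistsTwoConverse.RankOneTwoConverseCMSevenAdditiveTwo`,
K12₂″). HONEST FRAMING: nothing here proves K12₂″ or BSD; the family `49a1^{(−q)}`, `q ≡ 5 (mod 8)` prime, has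
twist-density zero (a witness family, never a closer of item 20044).

This is the first of four Theses-free files discharging conjunct (a) (= the half-trace relation (HT)) of the named
input `X049GenusHalfTraceFiveModEight` (`Theorems/GoldfeldK12AdditiveTwoHalfTrace.lean`) BY NAME from the typer's
Shimura-reciprocity fact `Literature.NumberTheory.EllipticCurves.heegnerPoints_shimuraReciprocity` (Darmon 2004,
Thm. 3.7; it provides lifts `P_Q ∈ E(H_K)` of the Heegner points and an isomorphism `θ : Cl(𝒪_{d_K}) ≃* Gal(H_K/K)`
transporting translation of classes) and its proved companions (`HeegnerPointsShimuraReciprocityProofs`,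
`HeegnerPointsGenusHalfTraceProofs`: Gross 1991 Prop. 5.3 summed over `Cl²`-cosets, and `θ(δ²)` fixes the coset sums).

* §1 Descent of points (folklore): a point of `W(L)` whose coordinates lie in the range of an injective algebra map
  `E → L` comes from `W(E)`; in particular points fixed by a subgroup `S ≤ Gal(L/F)` descend to the fixed field of `S`,
  and points fixed by all of `Gal(L/F)` (finite Galois) descend to `F`.
* §2 `p` is not a rational square; `q v² ≠ 7` for a prime `q ≠ 7`.
* §3 THE GENUS FIELD WITHOUT CLASS FIELD THEORY. For `K` imaginary quadratic with `d_K = −4q`, `q ≡ 1 (mod 4)` prime,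
  and ANY isomorphism `θ : Cl(𝒪_{d_K}) ≃* Gal(H_K/K)` (`H_K = singularModuliField K ι ⊂ ℂ`): the subgroup of squares
  `S = θ(Cl²)` has index `[Cl : Cl²] = 2^{μ−1} = 2` by the LANDED Gauss count (`index_range_sq_classGroup_QO`, Cox
  Prop. 3.11 / proof of Thm. 3.15, with `μ(−4q) = 2`, `assignedCharCount_neg_four_mul_of_mod_four_eq_one`), so its fixed
  field `J` has `[J : K] = 2`; `√q ∈ H_K` (Cox Thm. 6.1 at conductor `1`, tree theorem
  `sqrt_mem_ringClassField_one_of_discr_eq` + `ringClassField_one`) is fixed by every SQUARE (`σ√q = ±√q`), hence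
  `√q ∈ J`, and `√q ∉ K` (`q` is not a square in `ℚ(√−q)`); therefore `J = K ⊕ K√q = ℚ(i, √−q)`
  (`exists_eq_add_mul_sqrt`). This identifies the genus field WITHOUT the class-field-theoretic statement Cox Thm. 6.1 (ii)
  (named as a possible residual fact on the cell bus at 12:16Z): for `d_K = −4q` a degree count suffices.

Sequels: `…HalfTraceGenusInvolutions` (the involutions `ρ = θ(γ₀)|_J`, `τ = conj|_J`, the coordinates `i`,
`Fix(ρτ) = ℚ(i)`, `√−7 ∉ J`), `…HalfTraceLifts` (transport of partial sums of the lifts, the trace as half-trace plus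
conjugate, (HT) in `E(ℂ)`), `…HalfTraceOfShimuraReciprocity` (descent to `J`), and the cone file
`…HalfTraceOfShimuraReciprocityDatum` (the datum `X049GenusHalfTraceDatum` and the four consumers).

References: [Darmon2004] H. Darmon, *Rational Points on Modular Elliptic Curves*, CBMS 101 (2004), Thm. 3.7;
[GrossLMS1991] B. Gross, LMS LNS 153 (1991), Prop. 5.3; [Cox2013] D. Cox, *Primes of the form x² + ny²*, 2nd ed.
(2013), §3.A Prop. 3.11, §3.B Thm. 3.15, §6.A Thm. 6.1, §7.B Thm. 7.7; [SilvermanAEC2009] J. Silverman, *AEC*,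
III.3.1(b), VIII.§1 (Galois action on points).
-/

noncomputable section

open scoped Classical ComplexConjugate NNReal

open Literature.NumberTheory.EllipticCurves.ModularForms NumberField
open Literature.Computability.Cryptography.Hallgren2005
open Literature.Computability.Cryptography.Hallgren2005.OrderCl
open Literature.NumberTheory.QuadraticFields.Quadratic
open Literature.NumberTheory.QuadraticFields.BinaryQuadraticForm (assignedCharCount_neg_four_mul_of_mod_four_eq_one)

namespace Summit.BirchSwinnertonDyer.BirchSwinnertonDyer.Theorems.GoldfeldGoodTwists

open WeierstrassCurve Literature.NumberTheory.EllipticCurves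

/-! ## §1 Descent of points along field extensions -/

section Descent

variable {F E L : Type*} [Field F] [Field E] [Field L] [Algebra ℚ F] [Algebra ℚ E] [Algebra ℚ L]
  [Algebra F E] [Algebra F L] [IsScalarTower ℚ F E] [IsScalarTower ℚ F L]

/-- descent of a point along an injective algebra map. [folklore] -/
theorem exists_map_eq_of_coords (f : E →ₐ[F] L) (W : WeierstrassCurve ℚ)
    (P : (W.baseChange L).toAffine.Point)
    (hP : ∀ x y h, P = .some x y h → x ∈ Set.range f ∧ y ∈ Set.range f) :
    ∃ P₀ : (W.baseChange E).toAffine.Point, Affine.Point.map f P₀ = P := by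
  rcases P with _ | ⟨x, y, h⟩
  · exact ⟨0, rfl⟩
  · obtain ⟨⟨x₀, rfl⟩, ⟨y₀, rfl⟩⟩ := hP x y h rfl
    exact ⟨.some x₀ y₀ ((Affine.baseChange_nonsingular W f.injective x₀ y₀).mp h), rfl⟩

/-- descent to the fixed field of a subgroup. [folklore] -/
theorem exists_map_val_eq_of_forall_map_eq (W : WeierstrassCurve ℚ) (S : Subgroup Gal(L/F))
    (P : (W.baseChange L).toAffine.Point)
    (hP : ∀ σ ∈ S, Affine.Point.map (σ : L →ₐ[F] L) P = P) :
    ∃ P₀ : (W.baseChange (IntermediateField.fixedField S)).toAffine.Point,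
      Affine.Point.map (IntermediateField.fixedField S).val P₀ = P := by
  refine exists_map_eq_of_coords (IntermediateField.fixedField S).val W P fun x y h hP' ↦ ?_
  subst hP'
  have key : ∀ σ ∈ S, σ x = x ∧ σ y = y := fun σ hσ ↦ by
    have := hP σ hσ
    rw [Affine.Point.map_some] at this
    simpa only [Affine.Point.some.injEq, AlgEquiv.coe_toAlgHom] using this
  exact ⟨⟨⟨x, (IntermediateField.mem_fixedField_iff S x).mpr fun σ hσ ↦ (key σ hσ).1⟩, rfl⟩,
    ⟨⟨y, (IntermediateField.mem_fixedField_iff S y).mpr fun σ hσ ↦ (key σ hσ).2⟩, rfl⟩⟩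

/-- descent to the base of a finite Galois extension. [folklore] -/
theorem exists_map_eq_of_forall_gal [FiniteDimensional F L] [IsGalois F L] (W : WeierstrassCurve ℚ)
    (P : (W.baseChange L).toAffine.Point) (hP : ∀ σ : Gal(L/F), Affine.Point.map (σ : L →ₐ[F] L) P = P) :
    ∃ P₀ : (W.baseChange F).toAffine.Point, Affine.Point.map (Algebra.ofId F L) P₀ = P := by
  refine exists_map_eq_of_coords (Algebra.ofId F L) W P fun x y h hP' ↦ ?_
  subst hP'
  have key : ∀ σ : Gal(L/F), σ x = x ∧ σ y = y := fun σ ↦ by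
    have := hP σ
    rw [Affine.Point.map_some] at this
    simpa only [Affine.Point.some.injEq, AlgEquiv.coe_toAlgHom] using this
  exact ⟨(IsGalois.mem_range_algebraMap_iff_fixed x).mpr fun σ ↦ (key σ).1,
    (IsGalois.mem_range_algebraMap_iff_fixed y).mpr fun σ ↦ (key σ).2⟩

end Descent

/-! ## §2 Elementary arithmetic -/

section Arith

/-- a prime is not a rational square. [folklore] -/
theorem rat_sq_ne_natPrime {p : ℕ} (hp : p.Prime) (r : ℚ) : r ^ 2 ≠ p := by
  intro h
  have hr : r ≠ 0 := by
    rintro rfl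
    have : (p : ℚ) = 0 := by rw [← h]; norm_num
    exact hp.ne_zero (by exact_mod_cast this)
  haveI : Fact p.Prime := ⟨hp⟩
  have h1 : padicValRat p (r ^ 2) = padicValRat p p := by rw [h]
  rw [padicValRat.pow, padicValRat.self hp.one_lt] at h1
  have h0 : padicValRat p (p : ℚ) = 1 := padicValRat.self hp.one_lt
  omega

/-- `q v² ≠ 7` for a prime `q ≠ 7` and rational `v`. [folklore] -/
theorem prime_mul_rat_sq_ne_seven {q : ℕ} (hq : q.Prime) (hq7 : q ≠ 7) (v : ℚ) : (q : ℚ) * v ^ 2 ≠ 7 := by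
  intro h
  have hv : v ≠ 0 := by rintro rfl; norm_num at h
  haveI : Fact (Nat.Prime 7) := ⟨by norm_num⟩
  have hq0 : (q : ℚ) ≠ 0 := by exact_mod_cast hq.ne_zero
  have h1 : padicValRat 7 ((q : ℚ) * v ^ 2) = padicValRat 7 ((7 : ℕ) : ℚ) := by rw [h]; norm_num
  rw [padicValRat.mul hq0 (pow_ne_zero 2 hv), padicValRat.pow, padicValRat.self (by norm_num)] at h1
  have h7q : padicValRat 7 (q : ℚ) = 0 := by
    rw [← Nat.cast_ofNat, padicValRat.of_nat]
    have : padicValNat 7 q = 0 :=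
      padicValNat.eq_zero_of_not_dvd (fun h ↦ hq7 ((Nat.prime_dvd_prime_iff_eq (by norm_num) hq).mp h).symm)
    exact_mod_cast this
  rw [h7q] at h1
  omega

end Arith

/-! ## §3 The genus field inside the Hilbert class field: the fixed field of the squares -/

section GenusField

variable {K : Type} [Field K] [NumberField K]

/-- A group isomorphic to an abelian group is abelian. [folklore] -/
theorem mul_comm_of_mulEquiv_commGroup {G G' : Type*} [CommGroup G'] [Group G] (θ : G' ≃* G) (a b : G) :
    a * b = b * a := by
  obtain ⟨a, rfl⟩ := θ.surjective a
  obtain ⟨b, rfl⟩ := θ.surjective b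
  rw [← map_mul, ← map_mul, mul_comm]

/-- membership in the image of the squares. [folklore] -/
theorem mem_map_range_sq_iff {G G' : Type*} [CommGroup G'] [Group G] (θ : G' ≃* G) (g : G) :
    g ∈ ((powMonoidHom 2 : G' →* G').range).map θ.toMonoidHom ↔ ∃ δ : G', g = θ (δ ^ 2) := by
  simp only [Subgroup.mem_map, MonoidHom.mem_range, powMonoidHom_apply, MulEquiv.coe_toMonoidHom,
    exists_exists_eq_and]
  exact ⟨fun ⟨δ, h⟩ ↦ ⟨δ, h.symm⟩, fun ⟨δ, h⟩ ↦ ⟨δ, h.symm⟩⟩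

/-- every square lies in the image of the squares. [folklore] -/
theorem mul_self_mem_map_range_sq {G G' : Type*} [CommGroup G'] [Group G] (θ : G' ≃* G) (h : G) :
    h * h ∈ ((powMonoidHom 2 : G' →* G').range).map θ.toMonoidHom := by
  rw [mem_map_range_sq_iff]
  exact ⟨θ.symm h, by rw [map_pow, MulEquiv.apply_symm_apply, sq]⟩

/-- the image of the squares is a normal subgroup (the group being abelian). [folklore] -/
theorem normal_map_range_sq {G G' : Type*} [CommGroup G'] [Group G] (θ : G' ≃* G) :
    (((powMonoidHom 2 : G' →* G').range).map θ.toMonoidHom).Normal :=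
  ⟨fun n hn g ↦ by rwa [mul_comm_of_mulEquiv_commGroup θ g n, mul_assoc, mul_inv_cancel, mul_one]⟩

/-- `[Cl(𝒪_{-4q}) : Cl(𝒪_{-4q})²] = 2` for a prime `q ≡ 1 (mod 4)` (Gauss: `2^{μ-1}` with `μ = 2`).
[cite: Cox2013, §3.A Prop. 3.11 and §3.B Thm. 3.15 (proof)] -/
theorem index_range_sq_classGroup_negFourPrime (Δ : OrderCl.NegDiscr) {q : ℕ} (hq : q.Prime) (hq4 : q % 4 = 1)
    (hΔ : Δ.D = -(4 * (q : ℤ))) :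
    (powMonoidHom 2 : ClassGroup (OrderCl.QO Δ) →* ClassGroup (OrderCl.QO Δ)).range.index = 2 := by
  have hD4 : Δ.D % 4 = 0 ∨ Δ.D % 4 = 1 := Or.inl (by rw [hΔ]; omega)
  rw [index_range_sq_classGroup_QO Δ hD4, hΔ, show -(4 * (q : ℤ)) = -4 * (q : ℤ) by ring,
    assignedCharCount_neg_four_mul_of_mod_four_eq_one hq4, hq.primeFactors, Finset.card_singleton]
  norm_num

/-- `[Gal(H_K/K) : squares] = 2` for `d_K = -4q`. [cite: Cox2013, §3.A Prop. 3.11] -/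
theorem index_map_range_sq_eq_two (hK : IsImaginaryQuadratic K) (ι : K →+* ℂ)
    (θ : ClassGroup (OrderCl.QO hK.negDiscr) ≃* Gal(singularModuliField K ι/K)) {q : ℕ} (hq : q.Prime) (hq4 : q % 4 = 1)
    (hdK : NumberField.discr K = -(4 * (q : ℤ))) :
    (((powMonoidHom 2 : ClassGroup (OrderCl.QO hK.negDiscr) →* _).range).map θ.toMonoidHom).index = 2 := by
  rw [Subgroup.index_map_of_bijective (f := θ.toMonoidHom) θ.bijective]
  exact index_range_sq_classGroup_negFourPrime hK.negDiscr hq hq4 (by rw [IsImaginaryQuadratic.negDiscr_D, hdK])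

/-- `[H_K^{squares} : K] = 2` for `d_K = -4q`. [cite: Cox2013, §3.A Prop. 3.11] -/
theorem finrank_fixedField_map_range_sq (hK : IsImaginaryQuadratic K) (ι : K →+* ℂ)
    (θ : ClassGroup (OrderCl.QO hK.negDiscr) ≃* Gal(singularModuliField K ι/K)) {q : ℕ} (hq : q.Prime) (hq4 : q % 4 = 1)
    (hdK : NumberField.discr K = -(4 * (q : ℤ))) :
    Module.finrank K (IntermediateField.fixedField
      (((powMonoidHom 2 : ClassGroup (OrderCl.QO hK.negDiscr) →* _).range).map θ.toMonoidHom)) = 2 := by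
  obtain ⟨hfd, hgal⟩ := finiteDimensional_and_isGalois_singularModuliField irreducible_classPolynomial_holds hK ι
  set S := ((powMonoidHom 2 : ClassGroup (OrderCl.QO hK.negDiscr) →* _).range).map θ.toMonoidHom with hS
  have h1 := IntermediateField.finrank_fixedField_eq_card S
  have h2 := Module.finrank_mul_finrank K (IntermediateField.fixedField S) (singularModuliField K ι)
  have h3 := IsGalois.card_aut_eq_finrank K (singularModuliField K ι)
  have h4 := Subgroup.card_mul_index S
  have h5 := index_map_range_sq_eq_two hK ι θ hq hq4 hdK
  rw [← hS] at h5
  have hpos : 0 < Nat.card S := Nat.card_pos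
  rw [h1, ← h3, ← h4, h5] at h2
  exact Nat.eq_of_mul_eq_mul_right hpos (by linarith)

/-- `√q ∈ H_K` for `d_K = -4q`, `q ≡ 1 (mod 4)` (tree: Cox Thm. 6.1 at conductor 1). [cite: Cox2013, §6.A Thm. 6.1] -/
theorem sqrt_mem_singularModuliField (hK : IsImaginaryQuadratic K) (ι : K →+* ℂ) {q : ℕ} (hq : q.Prime) (hq4 : q % 4 = 1)
    (hdK : NumberField.discr K = -(4 * (q : ℤ))) :
    ((Real.sqrt q : ℝ) : ℂ) ∈ singularModuliField K ι := by
  rw [← ringClassField_one ι]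
  refine sqrt_mem_ringClassField_one_of_discr_eq hK ι hq hq4 hdK _ ?_
  rw [← Complex.ofReal_pow, Real.sq_sqrt (Nat.cast_nonneg q), Complex.ofReal_natCast]

/-- a Galois automorphism maps a square root of `q` to `±` itself. [folklore] -/
theorem gal_apply_sqrt {ι : K →+* ℂ} (σ : Gal(singularModuliField K ι/K)) {q : ℕ} {s : singularModuliField K ι}
    (hs : s ^ 2 = (q : singularModuliField K ι)) : σ s = s ∨ σ s = -s := by
  apply sq_eq_sq_iff_eq_or_eq_neg.mp
  rw [← map_pow, hs, map_natCast]

/-- `√q` lies in the fixed field of the squares. [folklore] -/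
theorem sqrt_mem_fixedField_map_range_sq (hK : IsImaginaryQuadratic K) (ι : K →+* ℂ)
    (θ : ClassGroup (OrderCl.QO hK.negDiscr) ≃* Gal(singularModuliField K ι/K)) {q : ℕ} {s : singularModuliField K ι}
    (hs : s ^ 2 = (q : singularModuliField K ι)) :
    s ∈ IntermediateField.fixedField
      (((powMonoidHom 2 : ClassGroup (OrderCl.QO hK.negDiscr) →* _).range).map θ.toMonoidHom) := by
  rw [IntermediateField.mem_fixedField_iff]
  intro g hg
  obtain ⟨δ, rfl⟩ := (mem_map_range_sq_iff θ g).mp hg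
  rw [map_pow, sq, AlgEquiv.mul_apply]
  rcases gal_apply_sqrt (θ δ) hs with h | h
  · rw [h, h]
  · rw [h, map_neg, h, neg_neg]

/-- `√(d_K/4) = √-q ∈ K`. [folklore] -/
theorem exists_sq_eq_neg_prime (hK : IsImaginaryQuadratic K) {q : ℕ} (hdK : NumberField.discr K = -(4 * (q : ℤ))) :
    ∃ θK : K, θK ^ 2 = -(q : K) := by
  obtain ⟨-, -, δ, -, hδ⟩ := exists_sq_eq_discr hK.1
  refine ⟨((δ : 𝓞 K) : K) / 2, ?_⟩
  have h : ((δ : 𝓞 K) : K) ^ 2 = (NumberField.discr K : K) := by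
    have := congrArg ((↑) : 𝓞 K → K) hδ
    simpa using this
  rw [div_pow, h, hdK]
  push_cast
  ring

/-- `√-q ∉ ℚ`. [folklore] -/
theorem sqrtNeg_not_mem_range_rat {q : ℕ} (hq : q.Prime) {θK : K} (hθ : θK ^ 2 = -(q : K)) :
    θK ∉ Set.range (algebraMap ℚ K) := by
  rintro ⟨a, ha⟩
  have h : ((a ^ 2 : ℚ) : K) = ((-(q : ℚ) : ℚ) : K) := by push_cast; rw [← hθ, ← ha]; rfl
  have h' : a ^ 2 = -(q : ℚ) := by exact_mod_cast h
  have : (0 : ℚ) < q := by exact_mod_cast hq.pos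
  nlinarith [sq_nonneg a]

/-- `q` is not a square in `K = ℚ(√-q)`. [folklore] -/
theorem sq_ne_prime_of_gen (hK : IsImaginaryQuadratic K) {q : ℕ} (hq : q.Prime) {θK : K} (hθ : θK ^ 2 = -(q : K)) (k : K) :
    k ^ 2 ≠ (q : K) := by
  intro hk
  have hθr := sqrtNeg_not_mem_range_rat hq hθ
  obtain ⟨a, b, rfl⟩ := exists_eq_add_mul hK.1 hθr k
  -- `(a + bθ)² = (a² - q b²) + 2ab θ`
  have hsq : (algebraMap ℚ K a + algebraMap ℚ K b * θK) ^ 2 =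
      algebraMap ℚ K (a ^ 2 - q * b ^ 2) + algebraMap ℚ K (2 * a * b) * θK := by
    simp only [map_sub, map_mul, map_pow, map_natCast, map_ofNat]
    linear_combination (algebraMap ℚ K b) ^ 2 * hθ
  rw [hsq, show (q : K) = algebraMap ℚ K q + algebraMap ℚ K 0 * θK by simp] at hk
  obtain ⟨h1, h2⟩ := ext_add_mul hθr hk
  rcases mul_eq_zero.mp h2 with h3 | h3
  · rcases mul_eq_zero.mp h3 with h4 | h4
    · norm_num at h4
    · rw [h4] at h1
      have : (0 : ℚ) < q := by exact_mod_cast hq.pos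
      nlinarith [sq_nonneg b]
  · rw [h3] at h1
    simp only [ne_eq, OfNat.ofNat_ne_zero, not_false_eq_true, zero_pow, mul_zero, sub_zero] at h1
    exact rat_sq_ne_natPrime hq a h1

/-- `√q ∉ K` inside `H_K`. [folklore] -/
theorem sqrt_not_mem_range_algebraMap (hK : IsImaginaryQuadratic K) (ι : K →+* ℂ) {q : ℕ} (hq : q.Prime) (hdK : NumberField.discr K = -(4 * (q : ℤ)))
    {s : singularModuliField K ι} (hs : s ^ 2 = (q : singularModuliField K ι)) :
    s ∉ Set.range (algebraMap K (singularModuliField K ι)) := by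
  rintro ⟨k, hk⟩
  obtain ⟨θK, hθ⟩ := exists_sq_eq_neg_prime hK hdK
  refine sq_ne_prime_of_gen hK hq hθ k ((algebraMap K (singularModuliField K ι)).injective ?_)
  rw [map_pow, hk, hs, map_natCast]

/-- the same for the fixed field `J` of the squares: `√q ∉ K` as an element of `J`. [folklore] -/
theorem sqrt_not_mem_range_algebraMap_fixedField (hK : IsImaginaryQuadratic K) (ι : K →+* ℂ) {q : ℕ} (hq : q.Prime)
    (hdK : NumberField.discr K = -(4 * (q : ℤ)))
    {J : IntermediateField K (singularModuliField K ι)} {s : J}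
    (hs : (s : singularModuliField K ι) ^ 2 = (q : singularModuliField K ι)) :
    s ∉ Set.range (algebraMap K J) := by
  rintro ⟨k, hk⟩
  refine sqrt_not_mem_range_algebraMap hK ι hq hdK hs ⟨k, ?_⟩
  rw [← hk]
  rfl

/-- **`J = K ⊕ K√q`** for the fixed field `J` of the squares, `d_K = -4q`. [cite: Cox2013, §6.A Thm. 6.1] -/
theorem exists_eq_add_mul_sqrt (hK : IsImaginaryQuadratic K) (ι : K →+* ℂ)
    (θ : ClassGroup (OrderCl.QO hK.negDiscr) ≃* Gal(singularModuliField K ι/K)) {q : ℕ} (hq : q.Prime) (hq4 : q % 4 = 1)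
    (hdK : NumberField.discr K = -(4 * (q : ℤ)))
    (s : IntermediateField.fixedField
      (((powMonoidHom 2 : ClassGroup (OrderCl.QO hK.negDiscr) →* _).range).map θ.toMonoidHom))
    (hs : (s : singularModuliField K ι) ^ 2 = (q : singularModuliField K ι))
    (x : IntermediateField.fixedField
      (((powMonoidHom 2 : ClassGroup (OrderCl.QO hK.negDiscr) →* _).range).map θ.toMonoidHom)) :
    ∃ a b : K, x = algebraMap K _ a + algebraMap K _ b * s :=
  exists_eq_add_mul (finrank_fixedField_map_range_sq hK ι θ hq hq4 hdK)
    (sqrt_not_mem_range_algebraMap_fixedField hK ι hq hdK hs) x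


end GenusField

end Summit.BirchSwinnertonDyer.BirchSwinnertonDyer.Theorems.GoldfeldGoodTwists

end
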